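import Literature.NumberTheory.PAdicHodge.BdRPlusGalois
import Literature.NumberTheory.PAdicHodge.FontaineThetaKernel
import Mathlib.RingTheory.WittVector.Complete
import HarnessLib

/-!
# The ring `B⁰_max = 𝔸_inf[ξ/p] ⊆ 𝔸_inf[1/p]`, its Frobenius and its Galois action

Let `F` be a non-archimedean local field of characteristic `0` and residue characteristic `p`,
`𝔸_inf(F) = W(𝒪_{ℂ_F}♭)` (tree `Ainf F`) with Fontaine's element `ξ = [p♭] − p` (tree `xi`,
`ker θ = ξ 𝔸_inf`), and `𝔸_inf[1/p]` (Mathlib `Localization.Away p`).  Berger (following Colmez)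
defines the crystalline period ring through
`B_max⁺ = {Σ_{n ≥ 0} a_n ω^n/p^n : a_n ∈ 𝔸_inf[1/p], a_n → 0}` for any generator `ω` of `ker θ`
("par exemple `[p̃] − p`"), `B_max = B_max⁺[1/t]`, crystalline = `B_max`-admissible
(Berger 2002, §1.2).  This file constructs the dense subring generated by the summands and the
two structures that `B_max⁺` inherits from it:

* `frobAinfLoc` — **the Frobenius `φ[1/p]` of `𝔸_inf[1/p]`** (localisation of the Witt-vector
  Frobenius), commuting with the Galois action `galAinfLoc` (`galAinfLoc_frobAinfLoc`);
* `xiDivP = ξ/p ∈ 𝔸_inf[1/p]` and **`bmaxZero F p = 𝔸_inf[ξ/p]`**, the `𝔸_inf`-subalgebra of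
  `𝔸_inf[1/p]` generated by `ξ/p` (so `B_max⁺` is its `p`-adic completion; Berger 2002 §1.2,
  Colmez 1998 §III.2);
* `exists_frobenius_xi_eq` — **`φ(ξ) = ξ^p + p·m`** with `m ∈ 𝔸_inf` (both sides have constant Witt
  coefficient `(p♭)^p`; Mathlib `WittVector.mem_span_p_iff_coeff_zero_eq_zero`), hence
  `φ(ξ/p) = p^{p-1} (ξ/p)^p + m` and **`φ(B⁰_max) ⊆ B⁰_max`** (`frobAinfLoc_mem_bmaxZero`);
* `exists_galAinf_xi_eq_mul` — **`σ(ξ) = c_σ · ξ`** (`ker θ` is `Γ_F`-stable and principal), hence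
  `σ(ξ/p) = c_σ · (ξ/p)` and **`σ(B⁰_max) ⊆ B⁰_max`** (`galAinfLoc_mem_bmaxZero`).

Definitions: `frobAinfLoc`, `xiDivP`, `bmaxZero`.  No named facts.

## References
* [BergerLaurent2002] L. Berger, *Représentations p-adiques et équations différentielles*,
  Invent. Math. 148 (2002), §1.2 (definition of `B_max⁺`, `B_max`, `φ`; p. 8 of arXiv:math/0102179).
* [FontaineAsterisque223III] J.-M. Fontaine, Astérisque 223 (1994), Exp. II §1.2, §2.3.
-/

noncomputable section

open WittVector Field ValuativeRel

namespace Literature.NumberTheory.PAdicHodge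

open Literature.NumberTheory.GaloisRepresentations
open Literature.NumberTheory.GaloisRepresentations.IsNonarchimedeanLocalField

variable {F : Type} [Field F] [ValuativeRel F] [TopologicalSpace F] [IsNonarchimedeanLocalField F]
  {p : ℕ} [Fact p.Prime] [Fact (¬ IsUnit (p : integerC F))]

/-! ### The Frobenius of `𝔸_inf[1/p]` -/

/-- `φ` maps the powers of `p` into themselves. [folklore] -/
theorem powers_le_comap_frobenius :
    Submonoid.powers (p : Ainf (p := p) F) ≤
      (Submonoid.powers (p : Ainf (p := p) F)).comap (WittVector.frobenius : Ainf (p := p) F →+* Ainf (p := p) F) := by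
  rintro _ ⟨n, rfl⟩
  exact ⟨n, by rw [map_pow, map_natCast]⟩

variable (F p) in
/-- **The Frobenius `φ[1/p]` of `𝔸_inf(F)[1/p]`** (localisation of the Witt-vector Frobenius of
`𝔸_inf = W(𝒪_{ℂ_F}♭)`). [cite: BergerLaurent2002, §1.2] -/
def frobAinfLoc : Localization.Away (p : Ainf (p := p) F) →+* Localization.Away (p : Ainf (p := p) F) :=
  IsLocalization.map (M := Submonoid.powers (p : Ainf (p := p) F)) (T := Submonoid.powers (p : Ainf (p := p) F))
    (Localization.Away (p : Ainf (p := p) F)) (WittVector.frobenius : Ainf (p := p) F →+* Ainf (p := p) F)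
    powers_le_comap_frobenius

/-- `frobAinfLoc` extends the Frobenius of `𝔸_inf`. [folklore] -/
@[simp] theorem frobAinfLoc_algebraMap (x : Ainf (p := p) F) :
    frobAinfLoc F p (algebraMap (Ainf (p := p) F) (Localization.Away (p : Ainf (p := p) F)) x) =
      algebraMap (Ainf (p := p) F) (Localization.Away (p : Ainf (p := p) F)) (WittVector.frobenius x) :=
  IsLocalization.map_eq _ _

/-- **`φ[1/p]` commutes with the Galois action on `𝔸_inf[1/p]`.** [cite: BergerLaurent2002, §1.2] -/
theorem galAinfLoc_frobAinfLoc (σ : absoluteGaloisGroup F) (x : Localization.Away (p : Ainf (p := p) F)) :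
    galAinfLoc σ (frobAinfLoc F p x) = frobAinfLoc F p (galAinfLoc σ x) := by
  have h : (galAinfLoc (p := p) (F := F) σ).comp (frobAinfLoc F p) = (frobAinfLoc F p).comp (galAinfLoc σ) := by
    refine IsLocalization.ringHom_ext (Submonoid.powers (p : Ainf (p := p) F)) (RingHom.ext fun y => ?_)
    rw [RingHom.comp_apply, RingHom.comp_apply, frobAinfLoc_algebraMap, galAinfLoc_algebraMap,
      RingHom.comp_apply, RingHom.comp_apply, galAinfLoc_algebraMap, frobAinfLoc_algebraMap, galAinf_frobenius]
  exact RingHom.congr_fun h x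

/-! ### `ξ/p` and `B⁰_max = 𝔸_inf[ξ/p]` -/

variable (F p) in
/-- **`ξ/p ∈ 𝔸_inf(F)[1/p]`.** [cite: BergerLaurent2002, §1.2] -/
def xiDivP : Localization.Away (p : Ainf (p := p) F) :=
  IsLocalization.mk' (Localization.Away (p : Ainf (p := p) F)) (xi : Ainf (p := p) F)
    ⟨(p : Ainf (p := p) F), Submonoid.mem_powers _⟩

/-- `p · (ξ/p) = ξ`. [folklore] -/
theorem algebraMap_natCast_mul_xiDivP :
    algebraMap (Ainf (p := p) F) (Localization.Away (p : Ainf (p := p) F)) p * xiDivP F p =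
      algebraMap (Ainf (p := p) F) (Localization.Away (p : Ainf (p := p) F)) xi :=
  IsLocalization.mk'_spec'_mk _ _ _ _

variable (F p) in
/-- **`B⁰_max = 𝔸_inf[ξ/p]`**, the `𝔸_inf`-subalgebra of `𝔸_inf[1/p]` generated by `ξ/p`; its `p`-adic
completion is Colmez's `B_max⁺ = {Σ a_n (ξ/p)^n, a_n → 0}` used by Berger to define crystalline
representations. [cite: BergerLaurent2002, §1.2] -/
def bmaxZero : Subalgebra (Ainf (p := p) F) (Localization.Away (p : Ainf (p := p) F)) :=
  Algebra.adjoin (Ainf (p := p) F) {xiDivP F p}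

/-- `ξ/p ∈ B⁰_max`. [folklore] -/
theorem xiDivP_mem_bmaxZero : xiDivP F p ∈ bmaxZero F p :=
  Algebra.subset_adjoin (Set.mem_singleton _)

/-- `𝔸_inf ⊆ B⁰_max`. [folklore] -/
theorem algebraMap_mem_bmaxZero (x : Ainf (p := p) F) :
    algebraMap (Ainf (p := p) F) (Localization.Away (p : Ainf (p := p) F)) x ∈ bmaxZero F p :=
  Subalgebra.algebraMap_mem _ x

/-! ### `φ(ξ) = ξ^p + p m` and the `φ`-stability of `B⁰_max` -/

/-- **`φ(ξ) ≡ ξ^p (mod p)`**: `φ(ξ) = ξ^p + p · m` for some `m ∈ 𝔸_inf` — both `φ(ξ)` and `ξ^p` have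
constant Witt coefficient `(p♭)^p`, and an element of `W(𝒪_{ℂ_F}♭)` with vanishing constant
coefficient is a multiple of `p` (the tilt is perfect). [cite: BergerLaurent2002, §1.2] -/
theorem exists_frobenius_xi_eq : ∃ m : Ainf (p := p) F,
    WittVector.frobenius (xi : Ainf (p := p) F) = xi ^ p + (p : Ainf (p := p) F) * m := by
  have h : (WittVector.frobenius (xi : Ainf (p := p) F) - xi ^ p) ∈ Ideal.span {(p : Ainf (p := p) F)} := by
    rw [WittVector.mem_span_p_iff_coeff_zero_eq_zero, ← constantCoeff_apply, map_sub, map_pow,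
      constantCoeff_apply, coeff_frobenius_charP, ← constantCoeff_apply, constantCoeff_xi, sub_self]
  obtain ⟨m, hm⟩ := Ideal.mem_span_singleton'.1 h
  exact ⟨m, by rw [mul_comm, hm, add_sub_cancel]⟩

/-- **`φ(ξ/p) = p^{p-1} (ξ/p)^p + m`** with `m` as in `exists_frobenius_xi_eq`. [cite: BergerLaurent2002, §1.2] -/
theorem exists_frobAinfLoc_xiDivP_eq : ∃ m : Ainf (p := p) F,
    frobAinfLoc F p (xiDivP F p) =
      algebraMap (Ainf (p := p) F) (Localization.Away (p : Ainf (p := p) F)) ((p : Ainf (p := p) F) ^ (p - 1)) *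
          xiDivP F p ^ p +
        algebraMap (Ainf (p := p) F) (Localization.Away (p : Ainf (p := p) F)) m := by
  obtain ⟨m, hm⟩ := exists_frobenius_xi_eq (F := F) (p := p)
  refine ⟨m, ?_⟩
  have hp1 : p - 1 + 1 = p := Nat.sub_add_cancel (Nat.Prime.one_le Fact.out)
  -- `φ[1/p] (ξ/p) = φ(ξ)/p`
  have h1 : frobAinfLoc F p (xiDivP F p) =
      IsLocalization.mk' (Localization.Away (p : Ainf (p := p) F)) (WittVector.frobenius (xi : Ainf (p := p) F))
        ⟨(p : Ainf (p := p) F), Submonoid.mem_powers _⟩ := by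
    rw [xiDivP, frobAinfLoc, IsLocalization.map_mk']
    congr 1
    exact Subtype.ext (map_natCast _ p)
  rw [h1, IsLocalization.mk'_eq_iff_eq_mul, hm]
  dsimp only
  have key := algebraMap_natCast_mul_xiDivP (F := F) (p := p)
  have hpow : (algebraMap (Ainf (p := p) F) (Localization.Away (p : Ainf (p := p) F)) (p : Ainf (p := p) F)) ^ p =
      algebraMap (Ainf (p := p) F) (Localization.Away (p : Ainf (p := p) F)) ((p : Ainf (p := p) F) ^ (p - 1)) *
        algebraMap (Ainf (p := p) F) (Localization.Away (p : Ainf (p := p) F)) (p : Ainf (p := p) F) := by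
    rw [map_pow, ← pow_succ, hp1]
  calc algebraMap (Ainf (p := p) F) (Localization.Away (p : Ainf (p := p) F)) (xi ^ p + (p : Ainf (p := p) F) * m)
      = (algebraMap (Ainf (p := p) F) (Localization.Away (p : Ainf (p := p) F)) (p : Ainf (p := p) F) * xiDivP F p) ^ p +
          algebraMap (Ainf (p := p) F) (Localization.Away (p : Ainf (p := p) F)) (p : Ainf (p := p) F) *
            algebraMap (Ainf (p := p) F) (Localization.Away (p : Ainf (p := p) F)) m := by
        rw [map_add, map_pow, map_mul, key]
    _ = _ := by
        rw [mul_pow, hpow]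
        ring

/-- **`φ(B⁰_max) ⊆ B⁰_max`.** [cite: BergerLaurent2002, §1.2] -/
theorem frobAinfLoc_mem_bmaxZero {x : Localization.Away (p : Ainf (p := p) F)} (hx : x ∈ bmaxZero F p) :
    frobAinfLoc F p x ∈ bmaxZero F p := by
  refine Algebra.adjoin_induction (fun y hy => ?_) (fun r => ?_) (fun y z _ _ hy hz => ?_) (fun y z _ _ hy hz => ?_) hx
  · rw [Set.mem_singleton_iff.1 hy]
    obtain ⟨m, hm⟩ := exists_frobAinfLoc_xiDivP_eq (F := F) (p := p)
    rw [hm]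
    exact add_mem (mul_mem (algebraMap_mem_bmaxZero _) (pow_mem xiDivP_mem_bmaxZero p)) (algebraMap_mem_bmaxZero m)
  · rw [frobAinfLoc_algebraMap]
    exact algebraMap_mem_bmaxZero _
  · rw [map_add]
    exact add_mem hy hz
  · rw [map_mul]
    exact mul_mem hy hz

/-! ### `σ(ξ) = c_σ ξ` and the Galois stability of `B⁰_max` -/

section Galois

variable [CharZero F] [IsAdicComplete (Ideal.span {(p : integerC F)}) (integerC F)]

/-- **`σ(ξ) = c_σ · ξ`** for some `c_σ ∈ 𝔸_inf`: `ker θ = ξ 𝔸_inf` is `Γ_F`-stable.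
[cite: FontaineAsterisque223III, Exp. II §1.5] -/
theorem exists_galAinf_xi_eq_mul (σ : absoluteGaloisGroup F) : ∃ c : Ainf (p := p) F, galAinf σ xi = c * xi := by
  have h := galAinf_mem_ker_fontaineTheta σ (xi_mem_ker (F := F) (p := p))
  rw [ker_fontaineTheta_eq_span_xi] at h
  obtain ⟨c, hc⟩ := Ideal.mem_span_singleton'.1 h
  exact ⟨c, hc.symm⟩

/-- **`σ(ξ/p) = c_σ · (ξ/p)`.** [folklore] -/
theorem exists_galAinfLoc_xiDivP_eq (σ : absoluteGaloisGroup F) : ∃ c : Ainf (p := p) F,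
    galAinfLoc σ (xiDivP F p) = algebraMap (Ainf (p := p) F) (Localization.Away (p : Ainf (p := p) F)) c * xiDivP F p := by
  obtain ⟨c, hc⟩ := exists_galAinf_xi_eq_mul (F := F) (p := p) σ
  refine ⟨c, ?_⟩
  have h1 : galAinfLoc σ (xiDivP F p) =
      IsLocalization.mk' (Localization.Away (p : Ainf (p := p) F)) (galAinf σ (xi : Ainf (p := p) F))
        ⟨(p : Ainf (p := p) F), Submonoid.mem_powers _⟩ := by
    rw [xiDivP, galAinfLoc, IsLocalization.map_mk']
    congr 1
    exact Subtype.ext (map_natCast _ p)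
  rw [h1, IsLocalization.mk'_eq_iff_eq_mul, hc, mul_assoc, mul_comm (xiDivP F p), algebraMap_natCast_mul_xiDivP,
    map_mul]

/-- **`σ(B⁰_max) ⊆ B⁰_max`.** [cite: BergerLaurent2002, §1.2] -/
theorem galAinfLoc_mem_bmaxZero (σ : absoluteGaloisGroup F) {x : Localization.Away (p : Ainf (p := p) F)}
    (hx : x ∈ bmaxZero F p) : galAinfLoc σ x ∈ bmaxZero F p := by
  refine Algebra.adjoin_induction (fun y hy => ?_) (fun r => ?_) (fun y z _ _ hy hz => ?_) (fun y z _ _ hy hz => ?_) hx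
  · rw [Set.mem_singleton_iff.1 hy]
    obtain ⟨c, hc⟩ := exists_galAinfLoc_xiDivP_eq (F := F) (p := p) σ
    rw [hc]
    exact mul_mem (algebraMap_mem_bmaxZero c) xiDivP_mem_bmaxZero
  · rw [galAinfLoc_algebraMap]
    exact algebraMap_mem_bmaxZero _
  · rw [map_add]
    exact add_mem hy hz
  · rw [map_mul]
    exact mul_mem hy hz

end Galois

/-! ### Appendix (φ-road of line `kato_lever`, crux K★ `stmt-BirchSwinnertonDyer-22226`): `B⁰_max` as a domain of characteristic `0`
with `p`-nilpotent images of `(p, ξ)`-nilpotent elements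

The data needed to instantiate the generic `p`-adic log-series theorems `Literature.RingTheory.FormalGroups.PadicLogSeries.*` with
`B = B⁰_max`: a `(p, ξ)`-nilpotent `y ∈ 𝔸_inf` (`y^N ∈ (p, ξ)`) becomes `p`-nilpotent in `B⁰_max` (`ξ = p·(ξ/p)` there), and `B⁰_max` is
a domain of characteristic `0` (so that natural numbers can be cancelled). -/

section PhiRoad

/-- **A `(p, ξ)`-nilpotent element of `𝔸_inf` is `p`-nilpotent in `B⁰_max`**: if `y^N ∈ (p, ξ)` then `y^N = p·z` in `B⁰_max` for some
`z ∈ B⁰_max` (`ξ = p·(ξ/p)`). [cite: BergerLaurent2002, §1.2] -/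
theorem exists_algebraMap_pow_eq_natCast_mul {y : Ainf (p := p) F} {N : ℕ} (hy : y ^ N ∈ Ideal.span {(p : Ainf (p := p) F), xi}) :
    ∃ z : bmaxZero F p, algebraMap (Ainf (p := p) F) (bmaxZero F p) y ^ N = (p : bmaxZero F p) * z := by
  obtain ⟨a, b, hab⟩ := Ideal.mem_span_pair.1 hy
  refine ⟨algebraMap (Ainf (p := p) F) (bmaxZero F p) a +
    algebraMap (Ainf (p := p) F) (bmaxZero F p) b * ⟨xiDivP F p, xiDivP_mem_bmaxZero⟩, Subtype.ext ?_⟩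
  have hp' : ((p : bmaxZero F p) : Localization.Away (p : Ainf (p := p) F)) =
      algebraMap (Ainf (p := p) F) (Localization.Away (p : Ainf (p := p) F)) p := by
    rw [map_natCast]; exact map_natCast (bmaxZero F p).val p
  rw [← map_pow, ← hab, Subalgebra.coe_mul, hp', Subalgebra.coe_add, Subalgebra.coe_mul]
  change algebraMap (Ainf (p := p) F) (Localization.Away (p : Ainf (p := p) F)) (a * (p : Ainf (p := p) F) + b * xi) =
    algebraMap (Ainf (p := p) F) (Localization.Away (p : Ainf (p := p) F)) p *
      (algebraMap (Ainf (p := p) F) (Localization.Away (p : Ainf (p := p) F)) a +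
        algebraMap (Ainf (p := p) F) (Localization.Away (p : Ainf (p := p) F)) b * xiDivP F p)
  rw [map_add, map_mul, map_mul, ← algebraMap_natCast_mul_xiDivP]
  ring

variable [CharZero F] [IsAdicComplete (Ideal.span {(p : integerC F)}) (integerC F)]

/-- `𝔸_inf(F)` has characteristic zero (`θ : 𝔸_inf → 𝒪_{ℂ_F} ⊂ ℂ_F` is a ring map to a ring of characteristic zero). [folklore] -/
private theorem charZero_ainf : CharZero (Ainf (p := p) F) := by
  haveI : CharZero (CompletedAlgClosure F) := charZero_of_injective_algebraMap (algebraMap F (CompletedAlgClosure F)).injective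
  exact ((integerC F).subtype.comp (fontaineTheta (integerC F) p)).charZero

/-- `p ≠ 0` in `𝔸_inf(F)`. [folklore] -/
private theorem natCast_prime_ne_zero : (p : Ainf (p := p) F) ≠ 0 := by
  haveI := charZero_ainf (F := F) (p := p)
  exact Nat.cast_ne_zero.2 (Fact.out : p.Prime).ne_zero

/-- **`𝔸_inf[1/p]` is a domain.** [cite: BergerLaurent2002, §1.2] -/
theorem isDomain_ainfLoc : IsDomain (Localization.Away (p : Ainf (p := p) F)) :=
  IsLocalization.isDomain_localization
    (powers_le_nonZeroDivisors_of_noZeroDivisors (natCast_prime_ne_zero (F := F) (p := p)))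

/-- **`B⁰_max` is a domain.** [cite: BergerLaurent2002, §1.2] -/
theorem isDomain_bmaxZero : IsDomain (bmaxZero F p) := by
  haveI := isDomain_ainfLoc (F := F) (p := p)
  infer_instance

/-- **`B⁰_max` has characteristic zero** (`𝔸_inf → 𝔸_inf[1/p]` is injective). [cite: BergerLaurent2002, §1.2] -/
theorem charZero_bmaxZero : CharZero (bmaxZero F p) := by
  haveI := charZero_ainf (F := F) (p := p)
  have hinj : Function.Injective (algebraMap (Ainf (p := p) F) (Localization.Away (p : Ainf (p := p) F))) :=
    IsLocalization.injective (Localization.Away (p : Ainf (p := p) F))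
      (powers_le_nonZeroDivisors_of_noZeroDivisors (natCast_prime_ne_zero (F := F) (p := p)))
  haveI : CharZero (Localization.Away (p : Ainf (p := p) F)) := charZero_of_injective_algebraMap hinj
  refine ⟨fun m n h => ?_⟩
  have h' := congrArg (bmaxZero F p).val h
  rw [map_natCast, map_natCast] at h'
  exact Nat.cast_injective h'

end PhiRoad

end Literature.NumberTheory.PAdicHodge

end
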